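import Summits.NavierStokesRegularity.NavierStokesRegularity.Theorems.EfficiencyFloorNearMaximiserBoundedAmplificationEarlyDeficit
import Summits.NavierStokesRegularity.NavierStokesRegularity.Theorems.EfficiencyFloorNearSaturationNearMaximiserAmplitude
import HarnessLib

/-!
# Route `EfficiencyFloor`, support `RigidExit` (stmt-NavierStokesRegularity-25513: `MaximiserSetRigidity → NearMaximiserBoundedAmplification`):
# SATURATION ⟺ NORMALISED MAXIMISER, and a NON-MAXIMISER INSTANT early in the window ⟹ a STRICT EARLY DEFICIT

Helper file (`--supports stmt-NavierStokesRegularity-25513`). The landed reduction `rigidExit_iff_partA_imp` (p823477) says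
the analytic content of `RigidExit` is «finitely many maximiser orbits ⟹ bounded amplification near maximisers», and the landed
`nearMaximiserBoundedAmplification_iff_earlyDeficit` (p824714) says bounded amplification is EQUIVALENT to a one-instant EARLY-DEFICIT
law at the interior time `s + η·W(s)` of the would-be blow-up window. This file supplies the two elementary links of the
«instant exit» mechanism between those statements and the route's objects:

* `saturated_iff_normalised` (static, three numbers of ONE admissible field `v` with `Z(v) > 0`, `c` one-sided admissible):
  the Lu–Doering cubic law is SATURATED, `(27c⁴/(128ν³))·Z³ ≤ 2S − 2ν·Pal`, IFF `v` is a NORMALISED MAXIMISER in the sense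
  of the route decls (`S = c·Z^{3/4}·Pal^{3/4}` and `Pal = (81c⁴/(256ν⁴))·Z³`) — the `δ = 0` case of the landed amplitude
  pinning `NearSaturationNearMaximiser.Amplitude.of_nearSaturation` (p819457) plus the converse computation
  `saturated_of_normalised`; `normalisedMaximiser_iff_saturated` is the same with the route's maximiser clause VERBATIM.
* `exists_budget_saturated_iff_normalisedMaximiser` (BY NAME, dynamic): for the sharp constant `c⋆`, along every maximal
  classical Leray–Hopf rapidly-decaying-datum solution the sharp budget of stmt-25481 (`Zr`, `D`, `D ≤ (27c⋆⁴/(128ν³))Zr³`)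
  satisfies, at every `t ∈ (0,T)`: `D t = (27c⋆⁴/(128ν³))·Zr t³` IFF the slice `u t` is a normalised maximiser.
* `inv_sq_sub_lt_of_strict_instant` (real analysis): under the cubic law on `[t₁,T)`, ONE instant `τ₀ ∈ [s, s')` with a
  STRICT inequality `Ż(τ₀) < K·Z(τ₀)³` makes the integrated law strict: `Z(s)⁻² − Z(s')⁻² < 2K(s' − s)`
  (`eventually_gt_of_hasDerivAt_pos`: a positive derivative lifts the monotone function `Z⁻² + 2Kτ` strictly).
* `earlyDeficit_pos_of_nonMaximiser_instant` (BY NAME, dynamic): for `c⋆` and every `0 < η < 1`: if after a slice time `s`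
  the instant `s' = s + η·W(s)` (`W(s) = (64ν³/(27c⋆⁴))·Z(u s)⁻²`) lies before `T` and SOME slice `u τ₀`, `τ₀ ∈ [s, s')`, is
  NOT a normalised maximiser, then the early-deficit inequality of p824714 holds at `s'` for THIS solution with SOME margin
  `θ > 0`: `(1 − η + 2θ)·Z(u s)⁻² ≤ Z(u s')⁻²`.

READING (exact remaining content of `RigidExit`, sizes): given clause (a) of `MaximiserSetRigidity` and the proved clause (b)
(p823327), what is still to be supplied is (i) ORBIT SELECTION [L]: a classical solution whose slices are normalised maximisers on
a time interval is a C¹ path inside ONE symmetry orbit (then `ProfileLiouville.no_movingOrbit_solution`, p823448, contradicts (b)),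
so by this file every maximiser's own evolution has a non-maximiser instant in `[0, ηW)` and hence a strict early deficit; and
(ii) CONTINUOUS DEPENDENCE [XL]: the margin `θ` at the single time `ηW` persists, uniformly (compactness modulo the symmetry
group, finitely many orbits), for slices `ε`-close to a maximiser in the scale-free `Ḣ¹∩Ḣ²` sense — then p824714 gives the item.
HONEST FRAMING: elementary facts about a HYPOTHETICAL blow-up and about three real numbers; `RigidExit`,
`NearMaximiserBoundedAmplification`, `MaximiserSetRigidity` (a), `LerayFloorGap`, `ProductionEfficiencyDecay` and Navier–Stokes
regularity stay OPEN; no summit statement is proved. [folklore]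
-/

-- the problem directory repeats the summit name (`NavierStokesRegularity/NavierStokesRegularity`)
set_option linter.dupNamespace false

noncomputable section

namespace Summit.NavierStokesRegularity.NavierStokesRegularity.Theorems

namespace RigidExit

open Set MeasureTheory Filter Topology Function
open scoped InnerProductSpace ENNReal
open Literature.Analysis.FluidPDE
open Summit.NavierStokesRegularity.NavierStokesRegularity.Theorems.ProductionEfficiencyDecay
open Summit.NavierStokesRegularity.NavierStokesRegularity.Theorems.NearMaximiserBoundedAmplification

/-! ## §1 Static: saturation of the cubic law ⟺ normalised maximiser -/

/-- **The Young-optimal amplitude saturates the cubic law** (converse computation): if `S = c·Z^{3/4}·P^{3/4}` and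
`P = (81c⁴/(256ν⁴))·Z³` with `Z ≥ 0`, `c ≥ 0`, `ν > 0`, then `2S − 2ν·P = (27c⁴/(128ν³))·Z³`. [cite: LuDoering2008, eq. (6)] -/
theorem saturated_of_normalised {c ν Z P S : ℝ} (hν : 0 < ν) (hc : 0 ≤ c) (hZ : 0 ≤ Z)
    (hS : S = c * Z ^ (3 / 4 : ℝ) * P ^ (3 / 4 : ℝ)) (hP : P = 81 * c ^ 4 / (256 * ν ^ 4) * Z ^ 3) :
    2 * S - 2 * ν * P = 27 * c ^ 4 / (128 * ν ^ 3) * Z ^ 3 := by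
  set a : ℝ := Z ^ (3 / 4 : ℝ) with ha
  have ha0 : 0 ≤ a := Real.rpow_nonneg hZ _
  have hZ3 : Z ^ 3 = a ^ 4 := by
    rw [ha, ← Real.rpow_mul_natCast hZ]
    norm_num
  set y : ℝ := 3 * c / (4 * ν) * a with hy
  have hy0 : 0 ≤ y := by positivity
  have hPy : P = y ^ 4 := by
    rw [hP, hZ3, hy]
    field_simp
    ring
  have hP34 : P ^ (3 / 4 : ℝ) = y ^ 3 := by
    rw [hPy, ← Real.rpow_natCast_mul hy0]
    norm_num
  rw [hS, hP34, hPy, hZ3, hy]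
  field_simp
  ring

/-- **Saturation ⟺ normalised maximiser** for ONE admissible field. Let `c > 0` be one-sided admissible
(`∫⟨ω,∇v ω⟩ ≤ c·Z^{3/4}·Pal^{3/4}` on smooth divergence-free fields with `D⁰,D¹,D² ∈ L²`), `ν > 0`, and `v` admissible with
`Z(v) = ∫‖curl v‖² > 0`. Then the cubic law is saturated at `v`, `(27c⁴/(128ν³))·Z³ ≤ 2S − 2ν·Pal`, IFF
`S = c·Z^{3/4}·Pal^{3/4}` and `Pal = (81c⁴/(256ν⁴))·Z³` (`→`: the `δ = 0` case of the landed amplitude pinning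
`NearSaturationNearMaximiser.Amplitude.of_nearSaturation`; `←`: `saturated_of_normalised`). [cite: LuDoering2008, eq. (6)] -/
theorem saturated_iff_normalised {c ν : ℝ} (hc : 0 < c) (hadm : ∀ v : EuclideanSpace ℝ (Fin 3) → EuclideanSpace ℝ (Fin 3), (ContDiff ℝ (⊤ : ℕ∞) v ∧
      Literature.Analysis.FluidPDE.VectorCalculus.IsDivFree v ∧ (∫⁻ x, ‖iteratedFDeriv ℝ 0 v x‖ₑ ^ 2 < ⊤) ∧ (∫⁻ x,
      ‖iteratedFDeriv ℝ 1 v x‖ₑ ^ 2 < ⊤) ∧ (∫⁻ x, ‖iteratedFDeriv ℝ 2 v x‖ₑ ^ 2 < ⊤)) → (∫ x,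
      ⟪Literature.Analysis.FluidPDE.curl v x, fderiv ℝ v x (Literature.Analysis.FluidPDE.curl v x)⟫_ℝ) ≤ c * (∫ x,
      ‖Literature.Analysis.FluidPDE.curl v x‖ ^ 2) ^ (3 / 4 : ℝ) * (∫ x,
      Literature.Analysis.FluidPDE.frobeniusNormSq (fderiv ℝ (Literature.Analysis.FluidPDE.curl v) x)) ^ (3 / 4 :
      ℝ))
    (hν : 0 < ν)
    (v : EuclideanSpace ℝ (Fin 3) → EuclideanSpace ℝ (Fin 3))
    (hv : (ContDiff ℝ (⊤ : ℕ∞) v ∧ Literature.Analysis.FluidPDE.VectorCalculus.IsDivFree v ∧ (∫⁻ x, ‖iteratedFDeriv ℝ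
      0 v x‖ₑ ^ 2 < ⊤) ∧ (∫⁻ x, ‖iteratedFDeriv ℝ 1 v x‖ₑ ^ 2 < ⊤) ∧ (∫⁻ x, ‖iteratedFDeriv ℝ 2 v x‖ₑ ^ 2 < ⊤)))
    (hZ : 0 < (∫ x, ‖Literature.Analysis.FluidPDE.curl v x‖ ^ 2)) :
    27 * c ^ 4 / (128 * ν ^ 3) * (∫ x, ‖Literature.Analysis.FluidPDE.curl v x‖ ^ 2) ^ 3 ≤ 2 * (∫ x,
      ⟪Literature.Analysis.FluidPDE.curl v x, fderiv ℝ v x (Literature.Analysis.FluidPDE.curl v x)⟫_ℝ) - 2 * ν *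
      (∫ x, Literature.Analysis.FluidPDE.frobeniusNormSq (fderiv ℝ (Literature.Analysis.FluidPDE.curl v) x)) ↔ ((∫
      x, ⟪Literature.Analysis.FluidPDE.curl v x, fderiv ℝ v x (Literature.Analysis.FluidPDE.curl v x)⟫_ℝ) = c * (∫
      x, ‖Literature.Analysis.FluidPDE.curl v x‖ ^ 2) ^ (3 / 4 : ℝ) * (∫ x,
      Literature.Analysis.FluidPDE.frobeniusNormSq (fderiv ℝ (Literature.Analysis.FluidPDE.curl v) x)) ^ (3 / 4 :
      ℝ) ∧ (∫ x, Literature.Analysis.FluidPDE.frobeniusNormSq (fderiv ℝ (Literature.Analysis.FluidPDE.curl v) x))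
      = 81 * c ^ 4 / (256 * ν ^ 4) * (∫ x, ‖Literature.Analysis.FluidPDE.curl v x‖ ^ 2) ^ 3) := by
  constructor
  · intro hsat
    have hsat' : (1 - 0) * (27 * c ^ 4 / (128 * ν ^ 3)) * (∫ x, ‖curl v x‖ ^ 2) ^ 3 ≤
        2 * (∫ x, ⟪curl v x, fderiv ℝ v x (curl v x)⟫_ℝ) - 2 * ν * (∫ x, frobeniusNormSq (fderiv ℝ (curl v) x)) := by
      rw [sub_zero, one_mul]; exact hsat
    obtain ⟨-, heff, -, hlo, hhi⟩ :=
      NearSaturationNearMaximiser.Amplitude.of_nearSaturation c ν 0 hc hadm hν le_rfl zero_lt_one v hv hZ hsat'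
    rw [sub_zero, one_mul] at heff
    rw [Real.sqrt_zero, sub_zero, one_pow, one_mul] at hlo
    rw [Real.sqrt_zero, add_zero, one_pow, one_mul] at hhi
    exact ⟨le_antisymm (hadm v hv) heff, le_antisymm hhi hlo⟩
  · rintro ⟨hS, hP⟩
    exact (saturated_of_normalised hν hc.le hZ.le hS hP).ge

/-- **The route's normalised-maximiser clause, unfolded**: `m` is a normalised maximiser for `(c, ν)` in the sense of
`MaximiserSetRigidity` / `NearMaximiserBoundedAmplification` (clause VERBATIM) IFF `m` is admissible with `Z(m) > 0` and
SATURATES the cubic law. [folklore] -/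
theorem normalisedMaximiser_iff_saturated {c ν : ℝ} (hc : 0 < c)
    (hadm : ∀ v : EuclideanSpace ℝ (Fin 3) → EuclideanSpace ℝ (Fin 3), (ContDiff ℝ (⊤ : ℕ∞) v ∧
      Literature.Analysis.FluidPDE.VectorCalculus.IsDivFree v ∧ (∫⁻ x, ‖iteratedFDeriv ℝ 0 v x‖ₑ ^ 2 < ⊤) ∧ (∫⁻ x,
      ‖iteratedFDeriv ℝ 1 v x‖ₑ ^ 2 < ⊤) ∧ (∫⁻ x, ‖iteratedFDeriv ℝ 2 v x‖ₑ ^ 2 < ⊤)) → (∫ x,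
      ⟪Literature.Analysis.FluidPDE.curl v x, fderiv ℝ v x (Literature.Analysis.FluidPDE.curl v x)⟫_ℝ) ≤ c * (∫ x,
      ‖Literature.Analysis.FluidPDE.curl v x‖ ^ 2) ^ (3 / 4 : ℝ) * (∫ x,
      Literature.Analysis.FluidPDE.frobeniusNormSq (fderiv ℝ (Literature.Analysis.FluidPDE.curl v) x)) ^ (3 / 4 :
      ℝ))
    (hν : 0 < ν)
    (v : EuclideanSpace ℝ (Fin 3) → EuclideanSpace ℝ (Fin 3)) :
    ((ContDiff ℝ (⊤ : ℕ∞) v ∧ Literature.Analysis.FluidPDE.VectorCalculus.IsDivFree v ∧ (∫⁻ x, ‖iteratedFDeriv ℝ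
      0 v x‖ₑ ^ 2 < ⊤) ∧ (∫⁻ x, ‖iteratedFDeriv ℝ 1 v x‖ₑ ^ 2 < ⊤) ∧ (∫⁻ x, ‖iteratedFDeriv ℝ 2 v x‖ₑ ^ 2 < ⊤)) ∧
      0 < (∫ x, ‖Literature.Analysis.FluidPDE.curl v x‖ ^ 2) ∧ (∫ x, ⟪Literature.Analysis.FluidPDE.curl v x,
      fderiv ℝ v x (Literature.Analysis.FluidPDE.curl v x)⟫_ℝ) = c * (∫ x, ‖Literature.Analysis.FluidPDE.curl v x‖
      ^ 2) ^ (3 / 4 : ℝ) * (∫ x, Literature.Analysis.FluidPDE.frobeniusNormSq (fderiv ℝ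
      (Literature.Analysis.FluidPDE.curl v) x)) ^ (3 / 4 : ℝ) ∧ (∫ x, Literature.Analysis.FluidPDE.frobeniusNormSq
      (fderiv ℝ (Literature.Analysis.FluidPDE.curl v) x)) = 81 * c ^ 4 / (256 * ν ^ 4) * (∫ x,
      ‖Literature.Analysis.FluidPDE.curl v x‖ ^ 2) ^ 3) ↔ ((ContDiff ℝ (⊤ : ℕ∞) v ∧
      Literature.Analysis.FluidPDE.VectorCalculus.IsDivFree v ∧ (∫⁻ x, ‖iteratedFDeriv ℝ 0 v x‖ₑ ^ 2 < ⊤) ∧ (∫⁻ x,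
      ‖iteratedFDeriv ℝ 1 v x‖ₑ ^ 2 < ⊤) ∧ (∫⁻ x, ‖iteratedFDeriv ℝ 2 v x‖ₑ ^ 2 < ⊤)) ∧ 0 < (∫ x,
      ‖Literature.Analysis.FluidPDE.curl v x‖ ^ 2) ∧ 27 * c ^ 4 / (128 * ν ^ 3) * (∫ x,
      ‖Literature.Analysis.FluidPDE.curl v x‖ ^ 2) ^ 3 ≤ 2 * (∫ x, ⟪Literature.Analysis.FluidPDE.curl v x, fderiv
      ℝ v x (Literature.Analysis.FluidPDE.curl v x)⟫_ℝ) - 2 * ν * (∫ x,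
      Literature.Analysis.FluidPDE.frobeniusNormSq (fderiv ℝ (Literature.Analysis.FluidPDE.curl v) x))) := by
  constructor
  · rintro ⟨hv, hZ, hS, hP⟩
    exact ⟨hv, hZ, (saturated_iff_normalised hc hadm hν v hv hZ).2 ⟨hS, hP⟩⟩
  · rintro ⟨hv, hZ, hsat⟩
    exact ⟨hv, hZ, (saturated_iff_normalised hc hadm hν v hv hZ).1 hsat⟩

/-! ## §2 Dynamic, BY NAME: the sharp budget is saturated at `t` ⟺ the slice `u t` is a normalised maximiser -/

/-- **Sharp budget with the saturation dictionary.** For the sharp one-sided Lu–Doering constant `c⋆` (clause of the route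
decls): along every maximal classical solution on `[0,T)` that is Leray–Hopf from a rapidly decaying datum, the sharp enstrophy
budget of stmt-25481 (`Zr`, `D` on `(0,T)`, VERBATIM) holds AND, at every `t ∈ (0,T)`, `D t = (27c⋆⁴/(128ν³))·(Zr t)³` IFF
the slice `u t` is a normalised maximiser (route clause verbatim). [folklore] -/
theorem exists_budget_saturated_iff_normalisedMaximiser :
    ∃ c : ℝ, (0 < c ∧ (∀ v : EuclideanSpace ℝ (Fin 3) → EuclideanSpace ℝ (Fin 3), (ContDiff ℝ (⊤ : ℕ∞) v ∧
      Literature.Analysis.FluidPDE.VectorCalculus.IsDivFree v ∧ (∫⁻ x, ‖iteratedFDeriv ℝ 0 v x‖ₑ ^ 2 < ⊤) ∧ (∫⁻ x,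
      ‖iteratedFDeriv ℝ 1 v x‖ₑ ^ 2 < ⊤) ∧ (∫⁻ x, ‖iteratedFDeriv ℝ 2 v x‖ₑ ^ 2 < ⊤)) → (∫ x,
      ⟪Literature.Analysis.FluidPDE.curl v x, fderiv ℝ v x (Literature.Analysis.FluidPDE.curl v x)⟫_ℝ) ≤ c * (∫ x,
      ‖Literature.Analysis.FluidPDE.curl v x‖ ^ 2) ^ (3 / 4 : ℝ) * (∫ x,
      Literature.Analysis.FluidPDE.frobeniusNormSq (fderiv ℝ (Literature.Analysis.FluidPDE.curl v) x)) ^ (3 / 4 :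
      ℝ)) ∧ ∀ c' : ℝ, (∀ w : EuclideanSpace ℝ (Fin 3) → EuclideanSpace ℝ (Fin 3), (ContDiff ℝ (⊤ : ℕ∞) w ∧
      Literature.Analysis.FluidPDE.VectorCalculus.IsDivFree w ∧ (∫⁻ x, ‖iteratedFDeriv ℝ 0 w x‖ₑ ^ 2 < ⊤) ∧ (∫⁻ x,
      ‖iteratedFDeriv ℝ 1 w x‖ₑ ^ 2 < ⊤) ∧ (∫⁻ x, ‖iteratedFDeriv ℝ 2 w x‖ₑ ^ 2 < ⊤)) → (∫ x,
      ⟪Literature.Analysis.FluidPDE.curl w x, fderiv ℝ w x (Literature.Analysis.FluidPDE.curl w x)⟫_ℝ) ≤ c' * (∫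
      x, ‖Literature.Analysis.FluidPDE.curl w x‖ ^ 2) ^ (3 / 4 : ℝ) * (∫ x,
      Literature.Analysis.FluidPDE.frobeniusNormSq (fderiv ℝ (Literature.Analysis.FluidPDE.curl w) x)) ^ (3 / 4 :
      ℝ)) → c ≤ c') ∧ ∀ (ν T : ℝ), 0 < ν → 0 < T → ∀ (u : ℝ → EuclideanSpace ℝ (Fin 3) → EuclideanSpace ℝ (Fin 3))
      (p : ℝ → EuclideanSpace ℝ (Fin 3) → ℝ), Literature.Analysis.FluidPDE.IsMaximalSmoothSolution ν 0 u p T →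
      Literature.Analysis.FluidPDE.IsLerayHopfOn T ν 0 (u 0) u → Literature.Analysis.FluidPDE.HasRapidSpatialDecay
      (u 0) → ∃ Zr D : ℝ → ℝ, (∀ t ∈ Set.Ioo 0 T, (∫⁻ x, ‖Literature.Analysis.FluidPDE.curl (u t) x‖ₑ ^ 2) =
      ENNReal.ofReal (Zr t) ∧ 0 ≤ Zr t ∧ (ContDiff ℝ (⊤ : ℕ∞) (u t) ∧
      Literature.Analysis.FluidPDE.VectorCalculus.IsDivFree (u t) ∧ (∫⁻ x, ‖iteratedFDeriv ℝ 0 (u t) x‖ₑ ^ 2 < ⊤)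
      ∧ (∫⁻ x, ‖iteratedFDeriv ℝ 1 (u t) x‖ₑ ^ 2 < ⊤) ∧ (∫⁻ x, ‖iteratedFDeriv ℝ 2 (u t) x‖ₑ ^ 2 < ⊤)) ∧ Zr t = (∫
      x, ‖Literature.Analysis.FluidPDE.curl (u t) x‖ ^ 2) ∧ HasDerivAt Zr (D t) t ∧ D t = 2 * (∫ x,
      ⟪Literature.Analysis.FluidPDE.curl (u t) x, fderiv ℝ (u t) x (Literature.Analysis.FluidPDE.curl (u t) x)⟫_ℝ)
      - 2 * ν * (∫ x, Literature.Analysis.FluidPDE.frobeniusNormSq (fderiv ℝ (Literature.Analysis.FluidPDE.curl (u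
      t)) x)) ∧ D t ≤ 27 * c ^ 4 / (128 * ν ^ 3) * Zr t ^ 3) ∧ ∀ t ∈ Set.Ioo 0 T, (D t = 27 * c ^ 4 / (128 * ν ^
      3) * Zr t ^ 3 ↔ ((ContDiff ℝ (⊤ : ℕ∞) (u t) ∧ Literature.Analysis.FluidPDE.VectorCalculus.IsDivFree (u t) ∧
      (∫⁻ x, ‖iteratedFDeriv ℝ 0 (u t) x‖ₑ ^ 2 < ⊤) ∧ (∫⁻ x, ‖iteratedFDeriv ℝ 1 (u t) x‖ₑ ^ 2 < ⊤) ∧ (∫⁻ x,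
      ‖iteratedFDeriv ℝ 2 (u t) x‖ₑ ^ 2 < ⊤)) ∧ 0 < (∫ x, ‖Literature.Analysis.FluidPDE.curl (u t) x‖ ^ 2) ∧ (∫ x,
      ⟪Literature.Analysis.FluidPDE.curl (u t) x, fderiv ℝ (u t) x (Literature.Analysis.FluidPDE.curl (u t) x)⟫_ℝ)
      = c * (∫ x, ‖Literature.Analysis.FluidPDE.curl (u t) x‖ ^ 2) ^ (3 / 4 : ℝ) * (∫ x,
      Literature.Analysis.FluidPDE.frobeniusNormSq (fderiv ℝ (Literature.Analysis.FluidPDE.curl (u t)) x)) ^ (3 /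
      4 : ℝ) ∧ (∫ x, Literature.Analysis.FluidPDE.frobeniusNormSq (fderiv ℝ (Literature.Analysis.FluidPDE.curl (u
      t)) x)) = 81 * c ^ 4 / (256 * ν ^ 4) * (∫ x, ‖Literature.Analysis.FluidPDE.curl (u t) x‖ ^ 2) ^ 3)) := by
  obtain ⟨c, hsharp, hbud⟩ := efficiencyFloor_sharpLuDoeringBudget_proof
  refine ⟨c, hsharp, fun ν T hν hT u p hmax hLH hdec => ?_⟩
  obtain ⟨Zr, D, hZD⟩ := hbud ν T hν hT u p hmax hLH hdec
  refine ⟨Zr, D, hZD, fun t ht => ?_⟩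
  have hc : 0 < c := hsharp.1
  obtain ⟨hlin, -, hadm_t, hZeq, -, hDeq, hDle⟩ := hZD t ht
  have hZpos : 0 < (∫ x, ‖curl (u t) x‖ ^ 2) := by
    have h1 := lintegral_curl_sq_pos hν hT hmax hLH hdec t ⟨ht.1.le, ht.2⟩
    rw [hlin] at h1
    rw [← hZeq]
    exact ENNReal.ofReal_pos.1 h1
  rw [normalisedMaximiser_iff_saturated hc hsharp.2.1 hν (u t), hDeq, hZeq]
  constructor
  · intro h
    exact ⟨hadm_t, hZpos, h.ge⟩
  · rintro ⟨-, -, h⟩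
    rw [hZeq] at hDle
    exact le_antisymm (by rw [hDeq] at hDle; exact hDle) h

/-! ## §3 Real analysis: one strict instant makes the integrated cubic law strict -/

/-- A function with positive derivative at `x` is, just to the right of `x`, above its value at `x`. [folklore] -/
theorem eventually_gt_of_hasDerivAt_pos {g : ℝ → ℝ} {g' x : ℝ} (hg : HasDerivAt g g' x) (hpos : 0 < g') :
    ∀ᶠ y in 𝓝[>] x, g x < g y := by
  -- adapted from Literature/Analysis/FluidPDE/CompressibleEulerImplosionTrapping.lean (eventually_lt_of_hasDerivAt_neg)
  have ht : Tendsto (slope g x) (𝓝[≠] x) (𝓝 g') := hasDerivAt_iff_tendsto_slope.mp hg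
  have h1 : ∀ᶠ y in 𝓝[≠] x, 0 < slope g x y := (tendsto_order.1 ht).1 0 hpos
  have h2 : ∀ᶠ y in 𝓝[>] x, 0 < slope g x y :=
    h1.filter_mono (nhdsWithin_mono x fun y hy => ne_of_gt hy)
  have h3 : ∀ᶠ y in 𝓝[>] x, x < y := eventually_mem_nhdsWithin
  filter_upwards [h2, h3] with y hy hxy
  rw [slope_def_field] at hy
  have hyx : 0 < y - x := sub_pos.mpr hxy
  have := (div_pos_iff.mp hy).resolve_right (fun h => absurd h.2 (not_lt.mpr hyx.le))
  linarith [this.1]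

/-- **One strict instant ⟹ strict integrated law.** If `Z > 0` on `[t₁,T)` has at every point a derivative `≤ K·Z³`, and at
some `τ₀ ∈ [s, s')` (`t₁ ≤ s`, `s' < T`) the derivative is STRICTLY below `K·Z(τ₀)³`, then
`Z(s)⁻² − Z(s')⁻² < 2K(s' − s)`. [folklore] -/
theorem inv_sq_sub_lt_of_strict_instant {Zr : ℝ → ℝ} {t₁ T K : ℝ}
    (hpos : ∀ t ∈ Ico t₁ T, 0 < Zr t)
    (hder : ∀ t ∈ Ico t₁ T, ∃ D : ℝ, HasDerivAt Zr D t ∧ D ≤ K * Zr t ^ 3)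
    {s τ₀ s' : ℝ} (hs : t₁ ≤ s) (hsτ : s ≤ τ₀) (hτs' : τ₀ < s') (hs'T : s' < T)
    {D₀ : ℝ} (hD₀ : HasDerivAt Zr D₀ τ₀) (hlt : D₀ < K * Zr τ₀ ^ 3) :
    (Zr s)⁻¹ ^ 2 - (Zr s')⁻¹ ^ 2 < 2 * K * (s' - s) := by
  -- the monotone function `g = Z⁻² + 2Kτ` has a positive derivative at `τ₀`
  set g : ℝ → ℝ := fun τ => (Zr τ)⁻¹ ^ 2 + 2 * K * τ with hg
  have hτ₀I : τ₀ ∈ Ico t₁ T := ⟨hs.trans hsτ, hτs'.trans hs'T⟩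
  have hZτ : 0 < Zr τ₀ := hpos τ₀ hτ₀I
  have hgd : HasDerivAt g (-2 * D₀ / Zr τ₀ ^ 3 + 2 * K * 1) τ₀ :=
    (hasDerivAt_inv_sq hD₀ hZτ.ne').add ((hasDerivAt_id τ₀).const_mul (2 * K))
  have hgpos : 0 < -2 * D₀ / Zr τ₀ ^ 3 + 2 * K * 1 := by
    have hZ3 : 0 < Zr τ₀ ^ 3 := pow_pos hZτ 3
    have h1 : D₀ / Zr τ₀ ^ 3 < K := (div_lt_iff₀ hZ3).2 hlt
    have h2 : -2 * D₀ / Zr τ₀ ^ 3 = -2 * (D₀ / Zr τ₀ ^ 3) := by ring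
    rw [h2]; linarith
  have hev := eventually_gt_of_hasDerivAt_pos hgd hgpos
  have hnear : ∀ᶠ y in 𝓝[>] τ₀, y ∈ Ioo τ₀ s' := Ioo_mem_nhdsGT hτs'
  obtain ⟨y, hgy, hy⟩ := (hev.and hnear).exists
  -- `g s ≤ g τ₀ < g y ≤ g s'`
  have h1 := stub_integrateEfficiency Zr t₁ T K hpos hder s τ₀ hs hsτ hτ₀I.2
  have h2 := stub_integrateEfficiency Zr t₁ T K hpos hder y s' (hs.trans (hsτ.trans hy.1.le)) hy.2.le hs'T
  have hgy' : (Zr τ₀)⁻¹ ^ 2 + 2 * K * τ₀ < (Zr y)⁻¹ ^ 2 + 2 * K * y := hgy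
  linarith

/-! ## §4 Dynamic, BY NAME: a non-maximiser instant early in the window ⟹ a strict early deficit -/

/-- **Non-maximiser instant ⟹ strict early deficit (for one solution).** For the sharp constant `c⋆` and every `0 < η < 1`:
along every maximal classical Leray–Hopf rapidly-decaying-datum solution, if for a slice time `s ∈ (0,T)` the instant
`s' = s + η·W(s)` (`W(s) = (64ν³/(27c⋆⁴))·Z(u s)⁻²`, the would-be blow-up window) lies before `T` and some slice `u τ₀` with
`τ₀ ∈ [s, s')` is NOT a normalised maximiser (route clause verbatim), then there is `θ > 0` with
`(1 − η + 2θ)·Z(u s)⁻² ≤ Z(u s')⁻²` — the early-deficit inequality of `nearMaximiserBoundedAmplification_iff_earlyDeficit`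
for this solution. (The margin `θ` is NOT claimed uniform: uniformity over `ε`-near-maximiser slices is the open content.)
[folklore] -/
theorem earlyDeficit_pos_of_nonMaximiser_instant :
    ∃ c : ℝ, (0 < c ∧ (∀ v : EuclideanSpace ℝ (Fin 3) → EuclideanSpace ℝ (Fin 3), (ContDiff ℝ (⊤ : ℕ∞) v ∧
      Literature.Analysis.FluidPDE.VectorCalculus.IsDivFree v ∧ (∫⁻ x, ‖iteratedFDeriv ℝ 0 v x‖ₑ ^ 2 < ⊤) ∧ (∫⁻ x,
      ‖iteratedFDeriv ℝ 1 v x‖ₑ ^ 2 < ⊤) ∧ (∫⁻ x, ‖iteratedFDeriv ℝ 2 v x‖ₑ ^ 2 < ⊤)) → (∫ x,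
      ⟪Literature.Analysis.FluidPDE.curl v x, fderiv ℝ v x (Literature.Analysis.FluidPDE.curl v x)⟫_ℝ) ≤ c * (∫ x,
      ‖Literature.Analysis.FluidPDE.curl v x‖ ^ 2) ^ (3 / 4 : ℝ) * (∫ x,
      Literature.Analysis.FluidPDE.frobeniusNormSq (fderiv ℝ (Literature.Analysis.FluidPDE.curl v) x)) ^ (3 / 4 :
      ℝ)) ∧ ∀ c' : ℝ, (∀ w : EuclideanSpace ℝ (Fin 3) → EuclideanSpace ℝ (Fin 3), (ContDiff ℝ (⊤ : ℕ∞) w ∧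
      Literature.Analysis.FluidPDE.VectorCalculus.IsDivFree w ∧ (∫⁻ x, ‖iteratedFDeriv ℝ 0 w x‖ₑ ^ 2 < ⊤) ∧ (∫⁻ x,
      ‖iteratedFDeriv ℝ 1 w x‖ₑ ^ 2 < ⊤) ∧ (∫⁻ x, ‖iteratedFDeriv ℝ 2 w x‖ₑ ^ 2 < ⊤)) → (∫ x,
      ⟪Literature.Analysis.FluidPDE.curl w x, fderiv ℝ w x (Literature.Analysis.FluidPDE.curl w x)⟫_ℝ) ≤ c' * (∫
      x, ‖Literature.Analysis.FluidPDE.curl w x‖ ^ 2) ^ (3 / 4 : ℝ) * (∫ x,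
      Literature.Analysis.FluidPDE.frobeniusNormSq (fderiv ℝ (Literature.Analysis.FluidPDE.curl w) x)) ^ (3 / 4 :
      ℝ)) → c ≤ c') ∧ ∀ η : ℝ, 0 < η → η < 1 → ∀ (ν T : ℝ), 0 < ν → 0 < T → ∀ (u : ℝ → EuclideanSpace ℝ (Fin 3) →
      EuclideanSpace ℝ (Fin 3)) (p : ℝ → EuclideanSpace ℝ (Fin 3) → ℝ),
      Literature.Analysis.FluidPDE.IsMaximalSmoothSolution ν 0 u p T → Literature.Analysis.FluidPDE.IsLerayHopfOn
      T ν 0 (u 0) u → Literature.Analysis.FluidPDE.HasRapidSpatialDecay (u 0) → ∀ s ∈ Set.Ioo 0 T, s + η * (64 * ν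
      ^ 3 / (27 * c ^ 4) * (∫ x, ‖Literature.Analysis.FluidPDE.curl (u s) x‖ ^ 2)⁻¹ ^ 2) < T → ∀ τ₀ ∈ Set.Ico s (s
      + η * (64 * ν ^ 3 / (27 * c ^ 4) * (∫ x, ‖Literature.Analysis.FluidPDE.curl (u s) x‖ ^ 2)⁻¹ ^ 2)), ¬
      ((ContDiff ℝ (⊤ : ℕ∞) (u τ₀) ∧ Literature.Analysis.FluidPDE.VectorCalculus.IsDivFree (u τ₀) ∧ (∫⁻ x,
      ‖iteratedFDeriv ℝ 0 (u τ₀) x‖ₑ ^ 2 < ⊤) ∧ (∫⁻ x, ‖iteratedFDeriv ℝ 1 (u τ₀) x‖ₑ ^ 2 < ⊤) ∧ (∫⁻ x,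
      ‖iteratedFDeriv ℝ 2 (u τ₀) x‖ₑ ^ 2 < ⊤)) ∧ 0 < (∫ x, ‖Literature.Analysis.FluidPDE.curl (u τ₀) x‖ ^ 2) ∧ (∫
      x, ⟪Literature.Analysis.FluidPDE.curl (u τ₀) x, fderiv ℝ (u τ₀) x (Literature.Analysis.FluidPDE.curl (u τ₀)
      x)⟫_ℝ) = c * (∫ x, ‖Literature.Analysis.FluidPDE.curl (u τ₀) x‖ ^ 2) ^ (3 / 4 : ℝ) * (∫ x,
      Literature.Analysis.FluidPDE.frobeniusNormSq (fderiv ℝ (Literature.Analysis.FluidPDE.curl (u τ₀)) x)) ^ (3 /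
      4 : ℝ) ∧ (∫ x, Literature.Analysis.FluidPDE.frobeniusNormSq (fderiv ℝ (Literature.Analysis.FluidPDE.curl (u
      τ₀)) x)) = 81 * c ^ 4 / (256 * ν ^ 4) * (∫ x, ‖Literature.Analysis.FluidPDE.curl (u τ₀) x‖ ^ 2) ^ 3) → ∃ θ :
      ℝ, 0 < θ ∧ (1 - η + 2 * θ) * (∫ x, ‖Literature.Analysis.FluidPDE.curl (u s) x‖ ^ 2)⁻¹ ^ 2 ≤ (∫ x,
      ‖Literature.Analysis.FluidPDE.curl (u (s + η * (64 * ν ^ 3 / (27 * c ^ 4) * (∫ x,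
      ‖Literature.Analysis.FluidPDE.curl (u s) x‖ ^ 2)⁻¹ ^ 2))) x‖ ^ 2)⁻¹ ^ 2 := by
  obtain ⟨c, hsharp, hbud⟩ := exists_budget_saturated_iff_normalisedMaximiser
  refine ⟨c, hsharp, fun η hη0 hη1 ν T hν hT u p hmax hLH hdec s hs hs'T τ₀ hτ₀ hnot => ?_⟩
  obtain ⟨Zr, D, hZD, hsat⟩ := hbud ν T hν hT u p hmax hLH hdec
  have hc : 0 < c := hsharp.1
  set K : ℝ := 27 * c ^ 4 / (128 * ν ^ 3) with hK
  have hKpos : 0 < K := by positivity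
  have he : 64 * ν ^ 3 / (27 * c ^ 4) = (2 * K)⁻¹ := by
    rw [hK]; field_simp; norm_num
  -- positivity and the cubic law for `Zr` on `[s, T)`
  have hpos : ∀ τ ∈ Ico s T, 0 < Zr τ := fun τ hτ => by
    have hτI : τ ∈ Ioo 0 T := ⟨hs.1.trans_le hτ.1, hτ.2⟩
    have h1 := lintegral_curl_sq_pos hν hT hmax hLH hdec τ ⟨hτI.1.le, hτI.2⟩
    rw [(hZD τ hτI).1] at h1
    exact ENNReal.ofReal_pos.1 h1
  have hder : ∀ τ ∈ Ico s T, ∃ D' : ℝ, HasDerivAt Zr D' τ ∧ D' ≤ K * Zr τ ^ 3 := fun τ hτ => by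
    have hτI : τ ∈ Ioo 0 T := ⟨hs.1.trans_le hτ.1, hτ.2⟩
    exact ⟨D τ, (hZD τ hτI).2.2.2.2.1, by rw [hK]; exact (hZD τ hτI).2.2.2.2.2.2⟩
  -- the strict instant `τ₀`
  have hW0 : 0 ≤ η * (64 * ν ^ 3 / (27 * c ^ 4) * (∫ x, ‖curl (u s) x‖ ^ 2)⁻¹ ^ 2) := by positivity
  have hτ₀I : τ₀ ∈ Ioo 0 T := ⟨hs.1.trans_le hτ₀.1, hτ₀.2.trans hs'T⟩
  have hDlt : D τ₀ < K * Zr τ₀ ^ 3 := by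
    have hle : D τ₀ ≤ K * Zr τ₀ ^ 3 := by rw [hK]; exact (hZD τ₀ hτ₀I).2.2.2.2.2.2
    rcases hle.lt_or_eq with h | h
    · exact h
    · exact absurd ((hsat τ₀ hτ₀I).1 (by rw [hK] at h; exact h)) hnot
  have hZs : (∫ x, ‖curl (u s) x‖ ^ 2) = Zr s := ((hZD s hs).2.2.2.1).symm
  rw [hZs, he] at hs'T hτ₀ ⊢
  have hs'I : s + η * ((2 * K)⁻¹ * (Zr s)⁻¹ ^ 2) ∈ Ioo 0 T := ⟨by rw [hZs, he] at hW0; linarith [hs.1], hs'T⟩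
  have hZs' : (∫ x, ‖curl (u (s + η * ((2 * K)⁻¹ * (Zr s)⁻¹ ^ 2))) x‖ ^ 2) =
      Zr (s + η * ((2 * K)⁻¹ * (Zr s)⁻¹ ^ 2)) := ((hZD _ hs'I).2.2.2.1).symm
  rw [hZs']
  have hstrict := inv_sq_sub_lt_of_strict_instant hpos hder le_rfl hτ₀.1 hτ₀.2 hs'T
    (hZD τ₀ hτ₀I).2.2.2.2.1 hDlt
  -- `2K·(s' − s) = η·Z(s)⁻²`
  have h2K : 2 * K * (s + η * ((2 * K)⁻¹ * (Zr s)⁻¹ ^ 2) - s) = η * (Zr s)⁻¹ ^ 2 := by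
    field_simp
    ring
  rw [h2K] at hstrict
  have hZs0 : 0 < Zr s := hpos s ⟨le_rfl, hs.2⟩
  have hX : 0 < (Zr s)⁻¹ ^ 2 := by positivity
  -- the margin
  refine ⟨((Zr (s + η * ((2 * K)⁻¹ * (Zr s)⁻¹ ^ 2)))⁻¹ ^ 2 - (1 - η) * (Zr s)⁻¹ ^ 2) / (2 * (Zr s)⁻¹ ^ 2),
    div_pos (by linarith) (by positivity), le_of_eq ?_⟩
  field_simp
  ring

end RigidExit

end Summit.NavierStokesRegularity.NavierStokesRegularity.Theorems

end
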